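import Mathlib
import Summits.Schanuel.Schanuel.Theorems.AclSubsetLogFreeCore.Negative.ExpAclField
import Summits.Schanuel.Schanuel.Theorems.AclSubsetLogFreeCore.Negative.LogFreeCoreCountable
import Literature.ModelTheory.ExponentialFields.DefinabilityParams
import Literature.ModelTheory.ExponentialFields.DefinableClosure

/-!
# Crux `AclSubsetLogFreeCore` — `acl` is idempotent, so (A) ⟺ "`C_EA` is `acl`-closed" and the admissible parameter sets of (A) are exactly the subsets of `C_EA`

Theorems for the crux (A) `RigidCore.AclSubsetLogFreeCore` (stmt-Schanuel-0968), all proved.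

* General model theory (any language `L`, any structure `M`; Marker, *Model Theory* §1.3,
  Exercise 1.4.11 folklore): the model-theoretic algebraic closure
  `modelAcl L A = ⋃ {s | s finite, A-definable}` is extensive, monotone, has finite character and is
  IDEMPOTENT / transitive: `modelAcl L (modelAcl L A) = modelAcl L A` (`modelAcl_modelAcl`). The key
  step `exists_finite_definable₁_superset_of_insert` eliminates one algebraic parameter `b ∈ t`
  (`t` finite `A`-definable) from a finite `(insert b A)`-definable set `s` by passing to
  `{x | ∃ u ∈ t, φ(x, u) ∧ "φ(·, u) has at most |s| solutions"}`.
* For `ℂ_exp`: `expAcl = modelAcl expRing ∅`; parameters from `acl(∅)` add nothing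
  (`modelAcl_subset_expAcl`).  Hence the EXACT load-bearing status of parameter-freeness in (A):
  **`modelAcl_subset_logFreeCore_iff_and : acl(P) ⊆ C_EA ↔ (A) ∧ P ⊆ C_EA`** — a parameter `p` is
  admissible iff `p ∈ C_EA` (given (A)), and fatal iff `p ∉ C_EA` (sharpens
  `aclSubsetLogFreeCore_false_with_one_real_param`); in particular **(A) ⟺ `acl(C_EA) = C_EA`**
  (`aclSubsetLogFreeCore_iff_modelAcl_logFreeCore`): the crux says precisely that the log-free core
  is an algebraically closed SUBSTRUCTURE of `ℂ_exp` in the model-theoretic sense — its own maximal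
  parametric strengthening.

## References

* [Marker2002] D. Marker, *Model Theory: An Introduction*, GTM 217, §1.3 and Exercise 1.4.11
  (`acl` is a closure operator of finite character; `acl(acl A) = acl A`).
* [TentZiegler2012] K. Tent, M. Ziegler, *A Course in Model Theory*, Lemma 5.6.? (`acl` transitive).
-/

noncomputable section

set_option linter.dupNamespace false

open FirstOrder FirstOrder.Language Set
open Literature.ModelTheory.ExponentialFields

namespace Summit.Schanuel.Schanuel.Theorems.AclSubsetLogFreeCore.Negative

/-! ## Model-theoretic algebraic closure in an arbitrary structure -/

section ModelTheory

universe u v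

variable (L : FirstOrder.Language.{u, v}) {M : Type*} [L.Structure M]

/-- The **model-theoretic algebraic closure** `acl(A)`: elements lying in some FINITE `A`-definable
subset of `M` (Marker 2002, §1.3). -/
def modelAcl (A : Set M) : Set M :=
  {b : M | ∃ s : Set M, s.Finite ∧ A.Definable₁ L s ∧ b ∈ s}

variable {L}

/-- Unfolding `acl`. -/
theorem mem_modelAcl_iff {A : Set M} {b : M} :
    b ∈ modelAcl L A ↔ ∃ s : Set M, s.Finite ∧ A.Definable₁ L s ∧ b ∈ s := Iff.rfl

/-- `acl` is extensive. -/
theorem subset_modelAcl (A : Set M) : A ⊆ modelAcl L A := fun a ha =>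
  ⟨{a}, Set.finite_singleton a, Set.Definable.singleton_of_mem L ha, rfl⟩

/-- `acl` is monotone. -/
theorem modelAcl_mono {A B : Set M} (h : A ⊆ B) : modelAcl L A ⊆ modelAcl L B := by
  rintro b ⟨s, hs, hdef, hb⟩
  exact ⟨s, hs, Set.Definable.mono hdef h, hb⟩

/-- `dcl(A) ⊆ acl(A)`. -/
theorem definableClosure_subset_modelAcl (A : Set M) :
    definableClosure L A ⊆ modelAcl L A := fun b hb =>
  ⟨{b}, Set.finite_singleton b, hb, rfl⟩

/-- **Elimination of one algebraic parameter.**  If `s` is a finite set definable over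
`insert b A` (`A` finite) and `b` lies in a finite `A`-definable set `t`, then `s` is contained in
a finite `A`-definable set: writing `s = φ(M, b)` with `N = |s|`, take
`s' = {x | ∃ u ∈ t, φ(x, u) ∧ ¬∃ (N+1) distinct solutions of φ(·, u)}`. -/
theorem exists_finite_definable₁_superset_of_insert {A : Set M} (hA : A.Finite) {b : M}
    {s t : Set M} (hs : (insert b A).Definable₁ L s) (hsfin : s.Finite)
    (ht : A.Definable₁ L t) (htfin : t.Finite) (hbt : b ∈ t) :
    ∃ s' : Set M, s ⊆ s' ∧ s'.Finite ∧ A.Definable₁ L s' := by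
  classical
  haveI : Finite ↥(insert b A) := (hA.insert b).to_subtype
  -- a formula for `s`, with all parameters displayed as variables
  obtain ⟨φ, hφ⟩ := Set.definable_iff_exists_formula_sum.1 hs
  set F : Set (↥(insert b A) ⊕ Fin 1 → M) := setOf φ.Realize with hFdef
  have hF : A.Definable L F := (Set.empty_definable_iff.2 ⟨φ, rfl⟩).mono (empty_subset A)
  -- plug the true parameters from `A` back in, keep a variable `u` in place of `b`:
  -- variables `Fin 1 ⊕ Fin 1` = `(x, u)`
  let Φ : (Fin 1 ⊕ Fin 1 → M) → (↥(insert b A) ⊕ Fin 1 → M) := fun w =>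
    Sum.elim (fun p => if (p : M) = b then w (Sum.inr 0) else (p : M)) (fun _ => w (Sum.inl 0))
  have hΦ : A.DefinableMap L Φ := by
    intro i
    rcases i with p | j
    · by_cases hp : (p : M) = b
      · simp only [Φ, Sum.elim_inl, hp, if_true]
        exact definableFun_proj_params _
      · have hpA : (p : M) ∈ A := (Set.mem_insert_iff.1 p.2).resolve_left hp
        simp only [Φ, Sum.elim_inl, hp, if_false]
        exact definableFun_const_params _ hpA
    · simp only [Φ, Sum.elim_inr]
      exact definableFun_proj_params _
  set G : Set (Fin 1 ⊕ Fin 1 → M) := Φ ⁻¹' F with hGdef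
  have hG : A.Definable L G := hF.preimage_map hΦ
  -- `Gp x u` : "`x` satisfies `φ` with the parameter `b` replaced by `u`"
  let pt : M → M → (Fin 1 ⊕ Fin 1 → M) := fun x u => Sum.elim (fun _ => x) (fun _ => u)
  have hG_b : ∀ x, pt x b ∈ G ↔ x ∈ s := by
    intro x
    have hΦb : Φ (pt x b) = Sum.elim (fun p : ↥(insert b A) => (p : M)) (fun _ : Fin 1 => x) := by
      funext i
      rcases i with p | j
      · simp only [Φ, pt, Sum.elim_inl, Sum.elim_inr]
        by_cases hp : (p : M) = b
        · rw [if_pos hp, hp]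
        · rw [if_neg hp]
      · rfl
    have h1 := Set.ext_iff.1 hφ (fun _ => x)
    simp only [mem_setOf_eq] at h1
    rw [hGdef, mem_preimage, hΦb, hFdef, mem_setOf_eq]
    exact h1.symm
  -- counting: `Bad u` = "more than `N` solutions"
  set N := hsfin.toFinset.card with hN
  let Bad : Set M := {u | ∃ y : Fin (N + 1) → M, Function.Injective y ∧ ∀ j, pt (y j) u ∈ G}
  let S' : Set M := {x | ∃ u, (u ∈ t ∧ pt x u ∈ G) ∧ u ∉ Bad}
  have hb_not_bad : b ∉ Bad := by
    rintro ⟨y, hy, hyG⟩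
    have hys : ∀ j, y j ∈ hsfin.toFinset := fun j => hsfin.mem_toFinset.2 ((hG_b (y j)).1 (hyG j))
    have hcard := Finset.card_le_card_of_injOn (s := Finset.univ) (t := hsfin.toFinset) y
      (fun j _ => hys j) hy.injOn
    rw [Finset.card_univ, Fintype.card_fin] at hcard
    omega
  refine ⟨S', fun x hx => ⟨b, ⟨hbt, (hG_b x).2 hx⟩, hb_not_bad⟩, ?_, ?_⟩
  · -- finiteness: a finite union (over `u ∈ t`) of fibres with at most `N` elements
    have hsub : S' ⊆ ⋃ u ∈ t, {x | pt x u ∈ G ∧ u ∉ Bad} := by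
      rintro x ⟨u, ⟨hut, hxu⟩, hub⟩
      exact Set.mem_biUnion hut ⟨hxu, hub⟩
    refine (htfin.biUnion fun u _ => ?_).subset hsub
    by_contra hinf
    have hinf' : {x | pt x u ∈ G ∧ u ∉ Bad}.Infinite := hinf
    obtain ⟨x₀, hx₀⟩ := hinf'.nonempty
    refine hx₀.2 ⟨fun j => (hinf'.natEmbedding _ j.1 : M), ?_, fun j => (hinf'.natEmbedding _ j.1).2.1⟩
    intro j k hjk
    exact Fin.ext ((hinf'.natEmbedding _).injective (Subtype.val_injective hjk))
  · -- definability
    -- variables `(x, u)`: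
    let r : Fin 1 ⊕ Fin 1 → Fin 1 ⊕ Unit := Sum.map id (fun _ => ())
    -- variables `((x, u), y)`; `q j` reads off `(y j, u)`:
    let q : Fin (N + 1) → (Fin 1 ⊕ Fin 1) → ((Fin 1 ⊕ Unit) ⊕ Fin (N + 1)) := fun j =>
      Sum.elim (fun _ => Sum.inr j) (fun _ => Sum.inl (Sum.inr ()))
    have hT₁ : A.Definable L {w : Fin 1 ⊕ Unit → M | w (Sum.inr ()) ∈ t} :=
      Set.Definable.preimage_comp (fun _ : Fin 1 => (Sum.inr () : Fin 1 ⊕ Unit)) ht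
    have hT₂ : A.Definable L {w : Fin 1 ⊕ Unit → M | w ∘ r ∈ G} := hG.preimage_comp r
    have hInj : A.Definable L {z : (Fin 1 ⊕ Unit) ⊕ Fin (N + 1) → M |
        ∀ j k, z (Sum.inr j) = z (Sum.inr k) → j = k} := by
      have : {z : (Fin 1 ⊕ Unit) ⊕ Fin (N + 1) → M | ∀ j k, z (Sum.inr j) = z (Sum.inr k) → j = k} =
          ⋂ j, ⋂ k, {z | z (Sum.inr j) = z (Sum.inr k) → j = k} := by
        ext z; simp [Set.mem_iInter]
      rw [this]
      refine Set.definable_iInter_of_finite fun j => Set.definable_iInter_of_finite fun k => ?_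
      refine definable_setOf_imp_params (definable_setOf_eq_params (definableFun_proj_params _)
        (definableFun_proj_params _)) ?_
      by_cases hjk : j = k <;> simp [hjk]
    have hAll : A.Definable L {z : (Fin 1 ⊕ Unit) ⊕ Fin (N + 1) → M | ∀ j, z ∘ q j ∈ G} := by
      have : {z : (Fin 1 ⊕ Unit) ⊕ Fin (N + 1) → M | ∀ j, z ∘ q j ∈ G} = ⋂ j, {z | z ∘ q j ∈ G} := by
        ext z; simp [Set.mem_iInter]
      rw [this]
      exact Set.definable_iInter_of_finite fun j => hG.preimage_comp (q j)
    have hT₃ : A.Definable L {w : Fin 1 ⊕ Unit → M | ∃ y : Fin (N + 1) → M,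
        Sum.elim w y ∈ {z : (Fin 1 ⊕ Unit) ⊕ Fin (N + 1) → M |
          ∀ j k, z (Sum.inr j) = z (Sum.inr k) → j = k} ∩ {z | ∀ j, z ∘ q j ∈ G}} :=
      (hInj.inter hAll).exists_of_finite
    have hT := (hT₁.inter hT₂).inter hT₃.compl
    have hS₁ := hT.exists_of_finite (β := Unit)
    -- identify with `{v | v 0 ∈ S'}`
    have key₁ : ∀ (v : Fin 1 → M) (u : Unit → M),
        Sum.elim v u ∘ r = pt (v 0) (u ()) := by
      intro v u; funext i
      rcases i with i | j
      · simp [r, pt, Fin.fin_one_eq_zero i]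
      · simp [r, pt]
    have key₂ : ∀ (v : Fin 1 → M) (u : Unit → M) (y : Fin (N + 1) → M) (j : Fin (N + 1)),
        Sum.elim (Sum.elim v u) y ∘ q j = pt (y j) (u ()) := by
      intro v u y j; funext i
      rcases i with i | i <;> simp [q, pt]
    have e : {v : Fin 1 → M | v 0 ∈ S'} = {v : Fin 1 → M | ∃ u : Unit → M,
        Sum.elim v u ∈ ({w : Fin 1 ⊕ Unit → M | w (Sum.inr ()) ∈ t} ∩ {w | w ∘ r ∈ G}) ∩
          {w : Fin 1 ⊕ Unit → M | ∃ y : Fin (N + 1) → M,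
            Sum.elim w y ∈ {z : (Fin 1 ⊕ Unit) ⊕ Fin (N + 1) → M |
              ∀ j k, z (Sum.inr j) = z (Sum.inr k) → j = k} ∩ {z | ∀ j, z ∘ q j ∈ G}}ᶜ} := by
      ext v
      simp only [S', Bad, mem_setOf_eq, mem_inter_iff, mem_compl_iff, Sum.elim_inr, key₁, key₂]
      constructor
      · rintro ⟨u, ⟨hut, hG'⟩, hbad⟩
        refine ⟨fun _ => u, ⟨hut, hG'⟩, ?_⟩
        rintro ⟨y, hyinj, hyG⟩
        exact hbad ⟨y, fun j k h => hyinj j k h, hyG⟩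
      · rintro ⟨u, ⟨hut, hG'⟩, hbad⟩
        refine ⟨u (), ⟨hut, hG'⟩, ?_⟩
        rintro ⟨y, hyinj, hyG⟩
        exact hbad ⟨y, fun j k h => hyinj h, hyG⟩
    show A.Definable L {v : Fin 1 → M | v 0 ∈ S'}
    rw [e]; exact hS₁

/-- Induction on finitely many algebraic parameters (finite base). -/
theorem exists_finite_definable₁_superset_aux {A₀ : Set M} (hA₀ : A₀.Finite) :
    ∀ T : Finset M, (↑T : Set M) ⊆ modelAcl L A₀ →
      ∀ s : Set M, s.Finite → (A₀ ∪ ↑T).Definable₁ L s →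
        ∃ s' : Set M, s ⊆ s' ∧ s'.Finite ∧ A₀.Definable₁ L s' := by
  classical
  intro T
  induction T using Finset.induction_on with
  | empty =>
    intro _ s hs hdef
    exact ⟨s, subset_rfl, hs, by simpa using hdef⟩
  | @insert b T hbT ih =>
    intro hT s hs hdef
    have hb : b ∈ modelAcl L A₀ := hT (by simp)
    have hT' : (↑T : Set M) ⊆ modelAcl L A₀ := fun z hz =>
      hT (by rw [Finset.coe_insert]; exact Set.mem_insert_of_mem _ hz)
    obtain ⟨t, htfin, htdef, hbt⟩ := hb
    have hfin : (A₀ ∪ ↑T : Set M).Finite := hA₀.union T.finite_toSet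
    have hdef' : (insert b (A₀ ∪ ↑T)).Definable₁ L s := by
      have : insert b (A₀ ∪ ↑T) = A₀ ∪ (↑(insert b T) : Set M) := by
        rw [Finset.coe_insert, Set.union_insert]
      rw [this]; exact hdef
    obtain ⟨s₁, hss₁, hs₁fin, hs₁def⟩ := exists_finite_definable₁_superset_of_insert hfin hdef'
      hs (Set.Definable.mono htdef subset_union_left) htfin hbt
    obtain ⟨s', hs₁s', hs'fin, hs'def⟩ := ih hT' s₁ hs₁fin hs₁def
    exact ⟨s', hss₁.trans hs₁s', hs'fin, hs'def⟩

/-- **`acl` is transitive**: parameters that are themselves algebraic over `A` can be eliminated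
(Marker 2002, Exercise 1.4.11). -/
theorem modelAcl_subset_modelAcl_of_subset {A B : Set M} (hB : B ⊆ modelAcl L A) :
    modelAcl L B ⊆ modelAcl L A := by
  classical
  rintro c ⟨s, hsfin, hsdef, hcs⟩
  obtain ⟨B₀, hB₀B, hs₀⟩ := Set.definable_iff_finitely_definable.1 hsdef
  have hpar : ∀ b ∈ B₀, ∃ A₁ : Finset M, (↑A₁ : Set M) ⊆ A ∧ b ∈ modelAcl L (↑A₁ : Set M) := by
    intro b hb
    obtain ⟨t, htfin, htdef, hbt⟩ := hB (hB₀B (Finset.mem_coe.2 hb))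
    obtain ⟨A₁, hA₁A, ht₁⟩ := Set.definable_iff_finitely_definable.1 htdef
    exact ⟨A₁, hA₁A, t, htfin, ht₁, hbt⟩
  choose! Af hAfA hAf using hpar
  set A₀ : Finset M := B₀.biUnion Af with hA₀def
  have hA₀A : (↑A₀ : Set M) ⊆ A := by
    intro z hz
    obtain ⟨b, hb, hzb⟩ := Finset.mem_biUnion.1 (Finset.mem_coe.1 hz)
    exact hAfA b hb (Finset.mem_coe.2 hzb)
  have hB₀acl : (↑B₀ : Set M) ⊆ modelAcl L (↑A₀ : Set M) := by
    intro b hb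
    have hb' := Finset.mem_coe.1 hb
    refine modelAcl_mono ?_ (hAf b hb')
    intro z hz
    exact Finset.mem_coe.2 (Finset.mem_biUnion.2 ⟨b, hb', Finset.mem_coe.1 hz⟩)
  obtain ⟨s', hss', hs'fin, hs'def⟩ := exists_finite_definable₁_superset_aux A₀.finite_toSet B₀
    hB₀acl s hsfin (Set.Definable.mono hs₀ subset_union_right)
  exact ⟨s', hs'fin, Set.Definable.mono hs'def hA₀A, hss' hcs⟩

/-- **`acl` is idempotent**: `acl(acl A) = acl A` (Marker 2002, Exercise 1.4.11). -/
theorem modelAcl_modelAcl (A : Set M) : modelAcl L (modelAcl L A) = modelAcl L A :=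
  Set.Subset.antisymm (modelAcl_subset_modelAcl_of_subset subset_rfl) (subset_modelAcl _)

/-- `acl(A)` is algebraically closed: `B ⊆ acl A → acl B ⊆ acl A`. -/
theorem modelAcl_subset_iff {A B : Set M} : modelAcl L B ⊆ modelAcl L A ↔ B ⊆ modelAcl L A :=
  ⟨fun h => (subset_modelAcl B).trans h, modelAcl_subset_modelAcl_of_subset⟩

end ModelTheory

/-! ## Application to the crux: which parameters may (A) use? -/

/-- `acl^{ℂ_exp}(∅)` of the crux is the model-theoretic `acl` of `∅` in `(ℂ, +, ·, −, 0, 1, exp)`. -/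
theorem expAcl_eq_modelAcl : expAcl = modelAcl Language.expRing (∅ : Set ℂ) := rfl

/-- Parameters from `acl(∅)` define no new finite sets: `acl(P) ⊆ acl(∅)` for `P ⊆ acl(∅)`. -/
theorem modelAcl_subset_expAcl {P : Set ℂ} (hP : P ⊆ expAcl) :
    modelAcl Language.expRing P ⊆ expAcl :=
  modelAcl_subset_modelAcl_of_subset hP

/-- In particular parameters from the log-free core `C_EA ⊆ acl(∅)` are harmless for `acl`. -/
theorem modelAcl_logFreeCore_subset_expAcl :
    modelAcl Language.expRing (logFreeCore : Set ℂ) ⊆ expAcl :=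
  modelAcl_subset_expAcl logFreeCore_subset_expAcl

/-- (A) with PARAMETERS from `P ⊆ ℂ` allowed in the defining formulas reads `acl^{ℂ_exp}(P) ⊆ C_EA`,
i.e. `modelAcl expRing P ⊆ logFreeCore`; unfolded it is the shape used in
`aclSubsetLogFreeCore_false_with_params_univ / _real / _with_one_real_param`. -/
theorem modelAcl_subset_logFreeCore_iff {P : Set ℂ} :
    modelAcl Language.expRing P ⊆ (logFreeCore : Set ℂ) ↔
      ∀ a : ℂ, (∃ s : Set ℂ, s.Finite ∧ Set.Definable₁ P Language.expRing s ∧ a ∈ s) →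
        a ∈ logFreeCore := Iff.rfl

/-- The crux is `acl(∅) ⊆ C_EA`. -/
theorem aclSubsetLogFreeCore_iff_modelAcl_empty :
    Summit.Schanuel.Schanuel.Theses.RigidCore.AclSubsetLogFreeCore ↔
      modelAcl Language.expRing (∅ : Set ℂ) ⊆ (logFreeCore : Set ℂ) :=
  Iff.rfl

/-- **The exact price of parameters**: `acl(P) ⊆ C_EA` iff (A) holds and `P ⊆ C_EA`.  So a parameter
`p` is fatal iff `p ∉ C_EA` (cf. `aclSubsetLogFreeCore_false_with_one_real_param`), and parameters
from the core are free. -/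
theorem modelAcl_subset_logFreeCore_iff_and {P : Set ℂ} :
    modelAcl Language.expRing P ⊆ (logFreeCore : Set ℂ) ↔
      (Summit.Schanuel.Schanuel.Theses.RigidCore.AclSubsetLogFreeCore ∧ P ⊆ (logFreeCore : Set ℂ)) := by
  constructor
  · intro h
    refine ⟨?_, (subset_modelAcl P).trans h⟩
    rw [aclSubsetLogFreeCore_iff]
    exact (modelAcl_mono (Set.empty_subset P)).trans h
  · rintro ⟨hA, hP⟩
    rw [aclSubsetLogFreeCore_iff] at hA
    exact (modelAcl_subset_expAcl (hP.trans logFreeCore_subset_expAcl)).trans hA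

/-- **(A) is equivalent to its maximal parametric strengthening** `acl(C_EA) ⊆ C_EA`, -/
theorem aclSubsetLogFreeCore_iff_modelAcl_logFreeCore_subset :
    Summit.Schanuel.Schanuel.Theses.RigidCore.AclSubsetLogFreeCore ↔
      modelAcl Language.expRing (logFreeCore : Set ℂ) ⊆ (logFreeCore : Set ℂ) := by
  rw [modelAcl_subset_logFreeCore_iff_and]; simp

/-- i.e. **(A) ⟺ the log-free core is `acl`-closed in `ℂ_exp`**: `acl^{ℂ_exp}(C_EA) = C_EA` — the
crux says precisely that `C_EA` is an algebraically closed substructure of `(ℂ, +, ·, exp)` in the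
model-theoretic sense. -/
theorem aclSubsetLogFreeCore_iff_modelAcl_logFreeCore :
    Summit.Schanuel.Schanuel.Theses.RigidCore.AclSubsetLogFreeCore ↔
      modelAcl Language.expRing (logFreeCore : Set ℂ) = (logFreeCore : Set ℂ) := by
  rw [aclSubsetLogFreeCore_iff_modelAcl_logFreeCore_subset]
  exact ⟨fun h => Set.Subset.antisymm h (subset_modelAcl _), fun h => h.le⟩

/-- One parameter: `acl(p) ⊆ C_EA ⟺ (A) ∧ p ∈ C_EA`. -/
theorem modelAcl_singleton_subset_logFreeCore_iff {p : ℂ} :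
    modelAcl Language.expRing ({p} : Set ℂ) ⊆ (logFreeCore : Set ℂ) ↔
      (Summit.Schanuel.Schanuel.Theses.RigidCore.AclSubsetLogFreeCore ∧ p ∈ logFreeCore) := by
  rw [modelAcl_subset_logFreeCore_iff_and, Set.singleton_subset_iff]; rfl

/-- A parameter outside the core is fatal (unconditionally; this is how
`aclSubsetLogFreeCore_false_with_one_real_param` arises) … -/
theorem not_modelAcl_singleton_subset_of_not_mem {p : ℂ} (hp : p ∉ logFreeCore) :
    ¬ (modelAcl Language.expRing ({p} : Set ℂ) ⊆ (logFreeCore : Set ℂ)) :=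
  fun h => hp (modelAcl_singleton_subset_logFreeCore_iff.1 h).2

/-- … a parameter inside the core is free: e.g. `π`, `2πi`, `e`, `e^π`, every algebraic number. -/
theorem modelAcl_singleton_subset_iff_of_mem {p : ℂ} (hp : p ∈ logFreeCore) :
    modelAcl Language.expRing ({p} : Set ℂ) ⊆ (logFreeCore : Set ℂ) ↔
      Summit.Schanuel.Schanuel.Theses.RigidCore.AclSubsetLogFreeCore := by
  rw [modelAcl_singleton_subset_logFreeCore_iff]; exact ⟨fun h => h.1, fun h => ⟨h, hp⟩⟩

/-- `π ∈ C_EA` (`π = 2πi / 2i`, `i` algebraic). -/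
theorem pi_mem_logFreeCore : (Real.pi : ℂ) ∈ logFreeCore := by
  have h2 : (2 * ↑Real.pi * Complex.I : ℂ) ∈ logFreeCore := two_pi_I_mem_logFreeCore
  -- `π = (2πi) / (2 i)` and `i` is algebraic, hence in the relatively algebraically closed core
  have hI : Complex.I ∈ logFreeCore := by
    refine logFreeCore_mem_coreFamily.2.2 _ ⟨Polynomial.X ^ 2 + 1, ?_, by simp⟩
    exact (Polynomial.monic_X_pow_add_C (1 : logFreeCore) two_ne_zero).ne_zero
  have h2' : (2 : ℂ) ∈ logFreeCore := by simp
  have : (Real.pi : ℂ) = (2 * ↑Real.pi * Complex.I) / (2 * Complex.I) := by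
    field_simp
  rw [this]
  exact div_mem h2 (mul_mem h2' hI)

/-- `acl(π) ⊆ C_EA ⟺ (A)`: the real period is a free parameter. -/
theorem modelAcl_pi_subset_iff :
    modelAcl Language.expRing ({(Real.pi : ℂ)} : Set ℂ) ⊆ (logFreeCore : Set ℂ) ↔
      Summit.Schanuel.Schanuel.Theses.RigidCore.AclSubsetLogFreeCore :=
  modelAcl_singleton_subset_iff_of_mem pi_mem_logFreeCore

/-- Parameters from all of `ℤ` are free as well. -/
theorem modelAcl_int_subset_iff :
    modelAcl Language.expRing (Set.range (Int.cast : ℤ → ℂ)) ⊆ (logFreeCore : Set ℂ) ↔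
      Summit.Schanuel.Schanuel.Theses.RigidCore.AclSubsetLogFreeCore := by
  rw [modelAcl_subset_logFreeCore_iff_and]
  refine ⟨fun h => h.1, fun h => ⟨h, ?_⟩⟩
  rintro _ ⟨n, rfl⟩
  exact intCast_mem logFreeCore n

end Summit.Schanuel.Schanuel.Theorems.AclSubsetLogFreeCore.Negative
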